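import Summits.CriticalPhenomena.CardyFormulaZ2.Theorems.CardyBoundaryCoulombGasBoundaryDefectGaussianRStubTransportPathsPart1

/-!
# Stub `stub_transportPaths` of line `rainbow-monomials-in-excursion-kernels` — Part 2:
# orientation of a rectilinear Jordan frontier ("interior on the left" propagates)
# (crux `CardyBoundaryCoulombGas.BoundaryDefectGaussianR`, stmt-CriticalPhenomena-14132)

(T3/T4, continuum part.) Let `D` be a Jordan domain whose frontier is covered by finitely many
axis-parallel segments, `γ = D.boundary`. Say `γ` has THE INTERIOR ON ITS LEFT at the parameter
`t` ("`Sq t`", written inline) if for the unit direction `τ` in which `γ` leaves `γ t`, the open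
square `γ t + τ (0, ε)²` (on the left of `τ`) lies in `D` for some `ε > 0`. Using the wedge of
Part 1 (`tp_wedgeAt`: near `γ t₀` the domain is the standard sector swept counter-clockwise from
the outgoing ray, or the complementary one):

* `tp_sq_of_first_out`, `tp_sq_of_first_in` — if the first alternative holds at `t₀`, then `Sq t`
  for all parameters `t` near `t₀` (on both germs);
* `tp_not_sq_of_second` — if the second alternative holds at `t₀`, then `¬ Sq t` near `t₀`;
* `tp_sq_all` — hence `Sq` is locally constant, so constant on `ℝ`; the orientation hypothesis of
  TRANSPORT at one parameter (`γ` leaves along `τ`, `γ t₁ + s τ i ∈ D` for small `s > 0`) excludes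
  the second alternative there, so `Sq` holds EVERYWHERE;
* `tp_wedgeAt_oriented` — consequently at EVERY parameter the first alternative holds: within `r`
  of `γ t₀` the domain is the standard sector of `m` quadrants swept counter-clockwise from the
  outgoing ray to the incoming ray (registered one-line form `s7_wedgeOriented`).
All [folklore].
-/

noncomputable section

open Set Filter Metric Topology
open Literature.Probability.RandomPlanarGeometry
open Summit.CriticalPhenomena.CardyFormulaZ2.Cruxes.RectilinearCardy.ExcursionKernelCovariance

namespace Summit.CriticalPhenomena.CardyFormulaZ2.Cruxes.BoundaryDefectGaussianR.RainbowMonomialsInExcursionKernels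

/-! ### Frame algebra -/

/-- Frame coordinate of a point written in the frame: `((p + i^a w) - p)(-i)^a = w`. [folklore] -/
theorem tp_frame_cancel (p w : ℂ) (a : ℕ) :
    (p + Complex.I ^ a * w - p) * (-Complex.I) ^ a = w := by
  rw [add_sub_cancel_left, mul_comm (Complex.I ^ a) w, mul_assoc, I_pow_mul_neg_I_pow, mul_one]

/-- Distances are read off the frame: `z - p = i^a w → dist z p = ‖w‖`. [folklore] -/
theorem tp_dist_of_frame {z p w : ℂ} {a : ℕ} (h : z - p = Complex.I ^ a * w) :
    dist z p = ‖w‖ := by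
  rw [dist_eq_norm, h, norm_mul, norm_pow, Complex.norm_I, one_pow, one_mul]

/-- Turning frames: `(i^(a+m) w)(-i)^a = i^m w`. [folklore] -/
theorem tp_frame_turn (w : ℂ) (a m : ℕ) :
    Complex.I ^ (a + m) * w * (-Complex.I) ^ a = Complex.I ^ m * w := by
  calc Complex.I ^ (a + m) * w * (-Complex.I) ^ a
        = Complex.I ^ m * w * (Complex.I ^ a * (-Complex.I) ^ a) := by rw [pow_add]; ring
    _ = Complex.I ^ m * w := by rw [I_pow_mul_neg_I_pow, mul_one]

/-- Turning frames the other way: `(i^a w)(-i)^(a+m) = w (-i)^m`. [folklore] -/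
theorem tp_frame_turn' (w : ℂ) (a m : ℕ) :
    Complex.I ^ a * w * (-Complex.I) ^ (a + m) = w * (-Complex.I) ^ m := by
  calc Complex.I ^ a * w * (-Complex.I) ^ (a + m)
        = w * (-Complex.I) ^ m * (Complex.I ^ a * (-Complex.I) ^ a) := by rw [pow_add]; ring
    _ = w * (-Complex.I) ^ m := by rw [I_pow_mul_neg_I_pow, mul_one]

/-- **Uniqueness of the outgoing direction.** Two unit vectors along which a curve leaves a point
on (possibly different) right parameter windows coincide. [folklore] -/
theorem tp_dir_unique {γ : ℝ → ℂ} {t ε ε' : ℝ} {τ τ' : ℂ} (hτ : ‖τ‖ = 1) (hτ' : ‖τ'‖ = 1)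
    (hε : 0 < ε) (hε' : 0 < ε')
    (h : ∀ t' ∈ Ioo t (t + ε), ∃ s : ℝ, 0 < s ∧ γ t' = γ t + (s : ℂ) * τ)
    (h' : ∀ t' ∈ Ioo t (t + ε'), ∃ s : ℝ, 0 < s ∧ γ t' = γ t + (s : ℂ) * τ') : τ = τ' := by
  have hm : 0 < min ε ε' := lt_min hε hε'
  obtain ⟨s, hs, hγs⟩ := h (t + min ε ε' / 2) ⟨by linarith, by linarith [min_le_left ε ε']⟩
  obtain ⟨s', hs', hγs'⟩ := h' (t + min ε ε' / 2) ⟨by linarith, by linarith [min_le_right ε ε']⟩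
  have heq : (s : ℂ) * τ = (s' : ℂ) * τ' := by
    have := hγs.symm.trans hγs'; exact add_left_cancel this
  have hss' : s = s' := by
    have hn := congrArg (fun w : ℂ => ‖w‖) heq
    simp only [norm_mul, Complex.norm_real, Real.norm_eq_abs, hτ, hτ', mul_one, abs_of_pos hs,
      abs_of_pos hs'] at hn
    exact hn
  rw [hss'] at heq
  exact mul_left_cancel₀ (by exact_mod_cast hs'.ne') heq

/-- One step along a straight germ: `γ t' - γ t = (‖γ t' - p‖ - ‖γ t - p‖) d`. [folklore] -/
theorem tp_germ_step {γ : ℝ → ℂ} {p d : ℂ} {t t' : ℝ}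
    (h : γ t = p + ((‖γ t - p‖ : ℝ) : ℂ) * d) (h' : γ t' = p + ((‖γ t' - p‖ : ℝ) : ℂ) * d) :
    γ t' = γ t + ((‖γ t' - p‖ - ‖γ t - p‖ : ℝ) : ℂ) * d := by
  generalize ‖γ t' - p‖ = A at h' ⊢
  generalize ‖γ t - p‖ = B at h ⊢
  rw [h', h]
  push_cast
  ring

/-- One step along a straight germ, backwards: `γ t' - γ t = (‖γ t - p‖ - ‖γ t' - p‖) (-d)`.
[folklore] -/
theorem tp_germ_step' {γ : ℝ → ℂ} {p d : ℂ} {t t' : ℝ}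
    (h : γ t = p + ((‖γ t - p‖ : ℝ) : ℂ) * d) (h' : γ t' = p + ((‖γ t' - p‖ : ℝ) : ℂ) * d) :
    γ t' = γ t + ((‖γ t - p‖ - ‖γ t' - p‖ : ℝ) : ℂ) * -d := by
  generalize ‖γ t' - p‖ = A at h' ⊢
  generalize ‖γ t - p‖ = B at h ⊢
  rw [h', h]
  push_cast
  ring

/-! ### `Sq` near a point where the first alternative holds -/

/-- **Interior on the left along the outgoing germ (first alternative).** If near `p = γ t₀` the
domain is the standard sector of `m` quadrants in the frame of the outgoing ray `i^a`, then at
every parameter `t ∈ [t₀, t₀ + η)` of the outgoing germ with `‖γ t - p‖ < r / 2`, the loop leaves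
`γ t` along `i^a` and the open square `γ t + i^a (0, r/4)²` lies in `D`. [folklore] -/
theorem tp_sq_of_first_out (D : JordanDomain) {t₀ r η : ℝ} {a m : ℕ} (hr : 0 < r)
    (hdirA : ∀ t ∈ Icc t₀ (t₀ + η), D.boundary t =
      D.boundary t₀ + ((‖D.boundary t - D.boundary t₀‖ : ℝ) : ℂ) * Complex.I ^ a)
    (hmonoA : StrictMonoOn (fun t => ‖D.boundary t - D.boundary t₀‖) (Icc t₀ (t₀ + η)))
    (hfirst : ∀ z, dist z (D.boundary t₀) < r → (z ∈ D.carrier ↔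
      (m = 1 → 0 < ((z - D.boundary t₀) * (-Complex.I) ^ a).re ∧
          0 < ((z - D.boundary t₀) * (-Complex.I) ^ a).im) ∧
        (m = 2 → 0 < ((z - D.boundary t₀) * (-Complex.I) ^ a).im) ∧
        (m = 3 → 0 < ((z - D.boundary t₀) * (-Complex.I) ^ a).im ∨
          ((z - D.boundary t₀) * (-Complex.I) ^ a).re < 0)))
    {t : ℝ} (ht : t ∈ Ico t₀ (t₀ + η)) (hft : ‖D.boundary t - D.boundary t₀‖ < r / 2) :
    ∃ τ : ℂ, ‖τ‖ = 1 ∧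
      (∃ ε : ℝ, 0 < ε ∧ ∀ t' ∈ Ioo t (t + ε), ∃ s : ℝ, 0 < s ∧
        D.boundary t' = D.boundary t + (s : ℂ) * τ) ∧
      (∃ ε : ℝ, 0 < ε ∧ ∀ x ∈ Ioo (0 : ℝ) ε, ∀ y ∈ Ioo (0 : ℝ) ε,
        D.boundary t + τ * ((x : ℂ) + (y : ℂ) * Complex.I) ∈ D.carrier) := by
  set γ := D.boundary with hγ
  set p := γ t₀ with hp
  refine ⟨Complex.I ^ a, by rw [norm_pow, Complex.norm_I, one_pow], ⟨t₀ + η - t, by linarith [ht.2],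
    fun t' ht' => ?_⟩, ⟨r / 4, by positivity, fun x hx y hy => ?_⟩⟩
  · have ht'I : t' ∈ Icc t₀ (t₀ + η) := ⟨by linarith [ht.1, ht'.1], by linarith [ht'.2]⟩
    have htI : t ∈ Icc t₀ (t₀ + η) := ⟨ht.1, ht.2.le⟩
    exact ⟨‖γ t' - p‖ - ‖γ t - p‖, sub_pos.2 (hmonoA htI ht'I ht'.1),
      tp_germ_step (hdirA t htI) (hdirA t' ht'I)⟩
  · have htI : t ∈ Icc t₀ (t₀ + η) := ⟨ht.1, ht.2.le⟩
    set w : ℂ := ((‖γ t - p‖ + x : ℝ) : ℂ) + (y : ℂ) * Complex.I with hw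
    have hzp : γ t + Complex.I ^ a * ((x : ℂ) + (y : ℂ) * Complex.I) - p = Complex.I ^ a * w := by
      rw [hdirA t htI, hw]; push_cast; ring
    have hwre : w.re = ‖γ t - p‖ + x := by simp [hw]
    have hwim : w.im = y := by simp [hw]
    have hu : (γ t + Complex.I ^ a * ((x : ℂ) + (y : ℂ) * Complex.I) - p) * (-Complex.I) ^ a
        = w := by
      rw [hzp, mul_comm (Complex.I ^ a) w, mul_assoc, I_pow_mul_neg_I_pow, mul_one]
    have hdist : dist (γ t + Complex.I ^ a * ((x : ℂ) + (y : ℂ) * Complex.I)) p < r := by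
      rw [tp_dist_of_frame hzp]
      refine lt_of_le_of_lt (Complex.norm_le_abs_re_add_abs_im w) ?_
      rw [hwre, hwim, abs_of_pos (by linarith [norm_nonneg (γ t - p), hx.1]), abs_of_pos hy.1]
      linarith [hx.2, hy.2]
    refine (hfirst _ hdist).2 ?_
    rw [hu, hwre, hwim]
    have h1 : 0 < ‖γ t - p‖ + x := by linarith [norm_nonneg (γ t - p), hx.1]
    exact ⟨fun _ => ⟨h1, hy.1⟩, fun _ => hy.1, fun _ => Or.inl hy.1⟩

/-- **Interior on the left along the incoming germ (first alternative).** If near `p = γ t₀` the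
domain is the standard sector of `m` quadrants in the frame of the outgoing ray `i^a`, the
incoming germ running along `i^(a+m)`, then at every parameter `t ∈ (t₀ - η, t₀)` with
`‖γ t - p‖ < r / 2`, the loop leaves `γ t` along `-i^(a+m)` and a small open square on the left of
this direction lies in `D`. [folklore] -/
theorem tp_sq_of_first_in (D : JordanDomain) {t₀ r η : ℝ} {a m : ℕ} (hr : 0 < r)
    (hm : m = 1 ∨ m = 2 ∨ m = 3)
    (hdirB : ∀ t ∈ Icc (t₀ - η) t₀, D.boundary t =
      D.boundary t₀ + ((‖D.boundary t - D.boundary t₀‖ : ℝ) : ℂ) * Complex.I ^ (a + m))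
    (hantiB : StrictAntiOn (fun t => ‖D.boundary t - D.boundary t₀‖) (Icc (t₀ - η) t₀))
    (hfirst : ∀ z, dist z (D.boundary t₀) < r → (z ∈ D.carrier ↔
      (m = 1 → 0 < ((z - D.boundary t₀) * (-Complex.I) ^ a).re ∧
          0 < ((z - D.boundary t₀) * (-Complex.I) ^ a).im) ∧
        (m = 2 → 0 < ((z - D.boundary t₀) * (-Complex.I) ^ a).im) ∧
        (m = 3 → 0 < ((z - D.boundary t₀) * (-Complex.I) ^ a).im ∨
          ((z - D.boundary t₀) * (-Complex.I) ^ a).re < 0)))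
    {t : ℝ} (ht : t ∈ Ioo (t₀ - η) t₀) (hft : ‖D.boundary t - D.boundary t₀‖ < r / 2) :
    ∃ τ : ℂ, ‖τ‖ = 1 ∧
      (∃ ε : ℝ, 0 < ε ∧ ∀ t' ∈ Ioo t (t + ε), ∃ s : ℝ, 0 < s ∧
        D.boundary t' = D.boundary t + (s : ℂ) * τ) ∧
      (∃ ε : ℝ, 0 < ε ∧ ∀ x ∈ Ioo (0 : ℝ) ε, ∀ y ∈ Ioo (0 : ℝ) ε,
        D.boundary t + τ * ((x : ℂ) + (y : ℂ) * Complex.I) ∈ D.carrier) := by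
  set γ := D.boundary with hγ
  set p := γ t₀ with hp
  have htI : t ∈ Icc (t₀ - η) t₀ := ⟨ht.1.le, ht.2.le⟩
  have hf0 : ‖γ t₀ - p‖ = 0 := by rw [hp, sub_self, norm_zero]
  have hftpos : 0 < ‖γ t - p‖ := by
    have h1 := hantiB htI ⟨by linarith [ht.1, ht.2], le_rfl⟩ ht.2
    simp only at h1
    rwa [hf0] at h1
  refine ⟨-Complex.I ^ (a + m), by rw [norm_neg, norm_pow, Complex.norm_I, one_pow],
    ⟨t₀ - t, by linarith [ht.2], fun t' ht' => ?_⟩,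
    ⟨min ‖γ t - p‖ (r / 4), lt_min hftpos (by positivity), fun x hx y hy => ?_⟩⟩
  · have ht'I : t' ∈ Icc (t₀ - η) t₀ := ⟨by linarith [ht.1, ht'.1], by linarith [ht'.2]⟩
    exact ⟨‖γ t - p‖ - ‖γ t' - p‖, sub_pos.2 (hantiB htI ht'I ht'.1),
      tp_germ_step' (hdirB t htI) (hdirB t' ht'I)⟩
  · have hxf : x < ‖γ t - p‖ := lt_of_lt_of_le hx.2 (min_le_left _ _)
    have hxr : x < r / 4 := lt_of_lt_of_le hx.2 (min_le_right _ _)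
    have hyr : y < r / 4 := lt_of_lt_of_le hy.2 (min_le_right _ _)
    set w : ℂ := ((‖γ t - p‖ - x : ℝ) : ℂ) - (y : ℂ) * Complex.I with hw
    have hzp : γ t + -Complex.I ^ (a + m) * ((x : ℂ) + (y : ℂ) * Complex.I) - p =
        Complex.I ^ (a + m) * w := by
      rw [hdirB t htI, hw]; push_cast; ring
    have hwre : w.re = ‖γ t - p‖ - x := by simp [hw]
    have hwim : w.im = -y := by simp [hw]
    have hu : (γ t + -Complex.I ^ (a + m) * ((x : ℂ) + (y : ℂ) * Complex.I) - p) *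
        (-Complex.I) ^ a = Complex.I ^ m * w := by
      rw [hzp, tp_frame_turn]
    have hdist : dist (γ t + -Complex.I ^ (a + m) * ((x : ℂ) + (y : ℂ) * Complex.I)) p < r := by
      rw [tp_dist_of_frame hzp]
      refine lt_of_le_of_lt (Complex.norm_le_abs_re_add_abs_im w) ?_
      rw [hwre, hwim, abs_of_pos (by linarith), abs_neg, abs_of_pos hy.1]
      linarith [hx.1, hy.1]
    refine (hfirst _ hdist).2 ?_
    rw [hu]
    have hA : 0 < ‖γ t - p‖ - x := by linarith
    rcases hm with rfl | rfl | rfl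
    · have e1 : (Complex.I ^ 1 * w).re = -w.im := by simp
      have e2 : (Complex.I ^ 1 * w).im = w.re := by simp
      rw [e1, e2, hwre, hwim]
      exact ⟨fun _ => ⟨by linarith [hy.1], hA⟩, fun h => absurd h (by norm_num),
        fun h => absurd h (by norm_num)⟩
    · have e2 : (Complex.I ^ 2 * w).im = -w.im := by simp
      rw [e2, hwim]
      exact ⟨fun h => absurd h (by norm_num), fun _ => by linarith [hy.1],
        fun h => absurd h (by norm_num)⟩
    · have e1 : (Complex.I ^ 3 * w).re = w.im := by simp [pow_succ]
      rw [e1, hwim]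
      exact ⟨fun h => absurd h (by norm_num), fun h => absurd h (by norm_num),
        fun _ => Or.inr (by linarith [hy.1])⟩

/-! ### `¬ Sq` near a point where the second alternative holds -/

/-- **No interior on the left near a point where the complementary sector is the domain.** If near
`p = γ t₀` the domain is the standard sector of `4 - m` quadrants in the frame of the INCOMING ray
`i^(a+m)` (the second alternative of `tp_wedgeAt`), then at no parameter `t ∈ (t₀ - η, t₀ + η)`
with `‖γ t - p‖ < r / 2` does the loop have the interior on its left. [folklore] -/
theorem tp_not_sq_of_second (D : JordanDomain) {t₀ r η : ℝ} {a m : ℕ} (hr : 0 < r)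
    (hm : m = 1 ∨ m = 2 ∨ m = 3)
    (hdirA : ∀ t ∈ Icc t₀ (t₀ + η), D.boundary t =
      D.boundary t₀ + ((‖D.boundary t - D.boundary t₀‖ : ℝ) : ℂ) * Complex.I ^ a)
    (hmonoA : StrictMonoOn (fun t => ‖D.boundary t - D.boundary t₀‖) (Icc t₀ (t₀ + η)))
    (hdirB : ∀ t ∈ Icc (t₀ - η) t₀, D.boundary t =
      D.boundary t₀ + ((‖D.boundary t - D.boundary t₀‖ : ℝ) : ℂ) * Complex.I ^ (a + m))
    (hantiB : StrictAntiOn (fun t => ‖D.boundary t - D.boundary t₀‖) (Icc (t₀ - η) t₀))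
    (hsecond : ∀ z, dist z (D.boundary t₀) < r → (z ∈ D.carrier ↔
      (4 - m = 1 → 0 < ((z - D.boundary t₀) * (-Complex.I) ^ (a + m)).re ∧
          0 < ((z - D.boundary t₀) * (-Complex.I) ^ (a + m)).im) ∧
        (4 - m = 2 → 0 < ((z - D.boundary t₀) * (-Complex.I) ^ (a + m)).im) ∧
        (4 - m = 3 → 0 < ((z - D.boundary t₀) * (-Complex.I) ^ (a + m)).im ∨
          ((z - D.boundary t₀) * (-Complex.I) ^ (a + m)).re < 0)))
    {t : ℝ} (ht : t ∈ Ioo (t₀ - η) (t₀ + η)) (hft : ‖D.boundary t - D.boundary t₀‖ < r / 2) :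
    ¬ ∃ τ : ℂ, ‖τ‖ = 1 ∧
      (∃ ε : ℝ, 0 < ε ∧ ∀ t' ∈ Ioo t (t + ε), ∃ s : ℝ, 0 < s ∧
        D.boundary t' = D.boundary t + (s : ℂ) * τ) ∧
      (∃ ε : ℝ, 0 < ε ∧ ∀ x ∈ Ioo (0 : ℝ) ε, ∀ y ∈ Ioo (0 : ℝ) ε,
        D.boundary t + τ * ((x : ℂ) + (y : ℂ) * Complex.I) ∈ D.carrier) := by
  set γ := D.boundary with hγ
  set p := γ t₀ with hp
  rintro ⟨τ, hτ, ⟨ε, hε, hgerm⟩, ⟨ε', hε', hsq⟩⟩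
  have hf0 : ‖γ t₀ - p‖ = 0 := by rw [hp, sub_self, norm_zero]
  rcases le_or_gt t₀ t with h0 | h0
  · -- `t` on the outgoing germ: `τ = i^a`
    have htI : t ∈ Icc t₀ (t₀ + η) := ⟨h0, ht.2.le⟩
    have hτa : τ = Complex.I ^ a := by
      refine tp_dir_unique (γ := γ) hτ (by rw [norm_pow, Complex.norm_I, one_pow]) hε
        (by linarith [ht.2] : 0 < t₀ + η - t) hgerm fun t' ht' => ?_
      have ht'I : t' ∈ Icc t₀ (t₀ + η) := ⟨by linarith [ht'.1], by linarith [ht'.2]⟩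
      exact ⟨‖γ t' - p‖ - ‖γ t - p‖, sub_pos.2 (hmonoA htI ht'I ht'.1),
        tp_germ_step (hdirA t htI) (hdirA t' ht'I)⟩
    subst hτa
    set x := min ε' (r / 4) / 2 with hx
    have hx0 : 0 < x := by rw [hx]; exact div_pos (lt_min hε' (by positivity)) two_pos
    have hxε : x < ε' := by rw [hx]; linarith [min_le_left ε' (r / 4), lt_min hε' (by positivity : 0 < r / 4)]
    have hxr : x < r / 4 := by rw [hx]; linarith [min_le_right ε' (r / 4), lt_min hε' (by positivity : 0 < r / 4)]
    have hzD := hsq x ⟨hx0, hxε⟩ x ⟨hx0, hxε⟩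
    set w : ℂ := ((‖γ t - p‖ + x : ℝ) : ℂ) + (x : ℂ) * Complex.I with hw
    have hzp : γ t + Complex.I ^ a * ((x : ℂ) + (x : ℂ) * Complex.I) - p = Complex.I ^ a * w := by
      rw [hdirA t htI, hw]; push_cast; ring
    have hwre : w.re = ‖γ t - p‖ + x := by simp [hw]
    have hwim : w.im = x := by simp [hw]
    have hu : (γ t + Complex.I ^ a * ((x : ℂ) + (x : ℂ) * Complex.I) - p) *
        (-Complex.I) ^ (a + m) = w * (-Complex.I) ^ m := by
      rw [hzp, tp_frame_turn']
    have hdist : dist (γ t + Complex.I ^ a * ((x : ℂ) + (x : ℂ) * Complex.I)) p < r := by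
      rw [tp_dist_of_frame hzp]
      refine lt_of_le_of_lt (Complex.norm_le_abs_re_add_abs_im w) ?_
      rw [hwre, hwim, abs_of_pos (by linarith [norm_nonneg (γ t - p)]), abs_of_pos hx0]
      linarith
    have hmem := (hsecond _ hdist).1 hzD
    rw [hu] at hmem
    have hA : 0 < ‖γ t - p‖ + x := by linarith [norm_nonneg (γ t - p)]
    rcases hm with rfl | rfl | rfl
    · have e1 : (w * (-Complex.I) ^ 1).re = w.im := by simp
      have e2 : (w * (-Complex.I) ^ 1).im = -w.re := by simp
      have h3 := hmem.2.2 (by norm_num)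
      rw [e1, e2, hwre, hwim] at h3
      rcases h3 with h3 | h3 <;> linarith
    · have e2 : (w * (-Complex.I) ^ 2).im = -w.im := by simp
      have h3 := hmem.2.1 (by norm_num)
      rw [e2, hwim] at h3
      linarith
    · have e1 : (w * (-Complex.I) ^ 3).re = -w.im := by simp [pow_succ]
      have h3 := (hmem.1 (by norm_num)).1
      rw [e1, hwim] at h3
      linarith
  · -- `t` on the incoming germ: `τ = -i^(a+m)`
    have htI : t ∈ Icc (t₀ - η) t₀ := ⟨ht.1.le, h0.le⟩
    have hftpos : 0 < ‖γ t - p‖ := by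
      have h1 := hantiB htI ⟨by linarith [ht.1, h0], le_rfl⟩ h0
      simp only at h1
      rwa [hf0] at h1
    have hτa : τ = -Complex.I ^ (a + m) := by
      refine tp_dir_unique (γ := γ) hτ (by rw [norm_neg, norm_pow, Complex.norm_I, one_pow]) hε
        (by linarith : 0 < t₀ - t) hgerm fun t' ht' => ?_
      have ht'I : t' ∈ Icc (t₀ - η) t₀ := ⟨by linarith [ht.1, ht'.1], by linarith [ht'.2]⟩
      exact ⟨‖γ t - p‖ - ‖γ t' - p‖, sub_pos.2 (hantiB htI ht'I ht'.1),
        tp_germ_step' (hdirB t htI) (hdirB t' ht'I)⟩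
    subst hτa
    set x := min (min ε' (r / 4)) ‖γ t - p‖ / 2 with hx
    have hM : 0 < min (min ε' (r / 4)) ‖γ t - p‖ := lt_min (lt_min hε' (by positivity)) hftpos
    have hx0 : 0 < x := by rw [hx]; exact div_pos hM two_pos
    have hxε : x < ε' := by
      have h1 : min (min ε' (r / 4)) ‖γ t - p‖ ≤ ε' := (min_le_left _ _).trans (min_le_left _ _)
      rw [hx]; linarith
    have hxr : x < r / 4 := by
      have h1 : min (min ε' (r / 4)) ‖γ t - p‖ ≤ r / 4 :=
        (min_le_left _ _).trans (min_le_right _ _)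
      rw [hx]; linarith
    have hxf : x < ‖γ t - p‖ := by
      rw [hx]; linarith [min_le_right (min ε' (r / 4)) ‖γ t - p‖]
    have hzD := hsq x ⟨hx0, hxε⟩ x ⟨hx0, hxε⟩
    set w : ℂ := ((‖γ t - p‖ - x : ℝ) : ℂ) - (x : ℂ) * Complex.I with hw
    have hzp : γ t + -Complex.I ^ (a + m) * ((x : ℂ) + (x : ℂ) * Complex.I) - p =
        Complex.I ^ (a + m) * w := by
      rw [hdirB t htI, hw]; push_cast; ring
    have hwre : w.re = ‖γ t - p‖ - x := by simp [hw]
    have hwim : w.im = -x := by simp [hw]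
    have hu : (γ t + -Complex.I ^ (a + m) * ((x : ℂ) + (x : ℂ) * Complex.I) - p) *
        (-Complex.I) ^ (a + m) = w := by
      rw [hzp, mul_comm (Complex.I ^ (a + m)) w, mul_assoc, I_pow_mul_neg_I_pow, mul_one]
    have hdist : dist (γ t + -Complex.I ^ (a + m) * ((x : ℂ) + (x : ℂ) * Complex.I)) p < r := by
      rw [tp_dist_of_frame hzp]
      refine lt_of_le_of_lt (Complex.norm_le_abs_re_add_abs_im w) ?_
      rw [hwre, hwim, abs_of_pos (by linarith), abs_neg, abs_of_pos hx0]
      linarith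
    have hmem := (hsecond _ hdist).1 hzD
    rw [hu, hwre, hwim] at hmem
    rcases hm with rfl | rfl | rfl
    · rcases hmem.2.2 (by norm_num) with h3 | h3 <;> linarith
    · linarith [hmem.2.1 (by norm_num)]
    · linarith [(hmem.1 (by norm_num)).2]

/-- **Registered sub-goal `s7_notLeftOfSecond` of stub `stub_transportPaths`** (one-line form of
`tp_not_sq_of_second`: where the complementary sector is the domain, the loop nowhere nearby has
the interior on its left). [folklore] -/
theorem s7_notLeftOfSecond : ∀ (D : Literature.Probability.RandomPlanarGeometry.JordanDomain) (t₀ r η : ℝ) (a m : ℕ), 0 < r → (m = 1 ∨ m = 2 ∨ m = 3) → (∀ t ∈ Set.Icc t₀ (t₀ + η), D.boundary t = D.boundary t₀ + ((‖D.boundary t - D.boundary t₀‖ : ℝ) : ℂ) * Complex.I ^ a) → StrictMonoOn (fun t ↦ ‖D.boundary t - D.boundary t₀‖) (Set.Icc t₀ (t₀ + η)) → (∀ t ∈ Set.Icc (t₀ - η) t₀, D.boundary t = D.boundary t₀ + ((‖D.boundary t - D.boundary t₀‖ : ℝ) : ℂ) * Complex.I ^ (a + m)) → StrictAntiOn (fun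 t ↦ ‖D.boundary t - D.boundary t₀‖) (Set.Icc (t₀ - η) t₀) → (∀ z, dist z (D.boundary t₀) < r → (z ∈ D.carrier ↔ (4 - m = 1 → 0 < ((z - D.boundary t₀) * (-Complex.I) ^ (a + m)).re ∧ 0 < ((z - D.boundary t₀) * (-Complex.I) ^ (a + m)).im) ∧ (4 - m = 2 → 0 < ((z - D.boundary t₀) * (-Complex.I) ^ (a + m)).im) ∧ (4 - m = 3 → 0 < ((z - D.boundary t₀) * (-Complex.I) ^ (a + m)).im ∨ ((z - D.boundary t₀) * (-Complex.I) ^ (a + m)).re < 0))) → ∀ (t : ℝ), t ∈ Set.Ioo (t₀ - η) (t₀ + η) → ‖D.boundary t - D.boundary t₀‖ < r / 2 → ¬ ∃ τ : ℂ, ‖τ‖ = 1 ∧ (∃ ε : ℝ, 0 < ε ∧ ∀ t' ∈ Set.Ioo t (t + ε), ∃ s : ℝ, 0 < s ∧ D.boundary t' = D.boundary t + (s : ℂ) * τ) ∧ (∃ ε : ℝ, 0 < ε ∧ ∀ x ∈ Set.Ioo (0 : ℝ) ε, ∀ y ∈ Set.Ioo (0 : ℝ) ε, D.boundary t + τ *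 ((x : ℂ) + (y : ℂ) * Complex.I) ∈ D.carrier) :=
  fun D _ _ _ _ _ hr hm hdirA hmonoA hdirB hantiB hsecond _ ht hft =>
    tp_not_sq_of_second D hr hm hdirA hmonoA hdirB hantiB hsecond ht hft

end Summit.CriticalPhenomena.CardyFormulaZ2.Cruxes.BoundaryDefectGaussianR.RainbowMonomialsInExcursionKernels

end
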